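import Literature.NumberTheory.GelbartRogawski1991.LocalDoubledBlockSiegel
import Literature.NumberTheory.GelbartRogawski1991.LocalSplittingCMGaloisTransportRigidity
import HarnessLib

-- as in the GelbartRogawski1991 siblings: elaborate sequentially (deterministic elaboration order for the large telescopes).
set_option Elab.async false

/-!
# The local see-saw for Kudla's CM splitting: the `χ`-splitting of `U(V₁ ⊥ V₂)(F_v)` restricts to the `χ`-splitting
# of `U(V₁)(F_v)` — «the restriction of `ω_{V,χ}` to `U(V₁)` is `ω_{V₁,χ} ⊠ 1`» ([Kudla1994, Thm. 3.1]; [Kudla1984, §1])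

Topic `NumberTheory/GelbartRogawski1991`; namespace
`Literature.NumberTheory.GelbartRogawski1991.UnitaryDualPair.LocalSplitting.DoubledBlock` (sequel of `LocalDoubledBlockEmbedding`).
KERNEL ONLY: theorems; no definition, no named fact, no `sorry`.  The LOCAL, one-place twin of the tree's adelic see-saw
`DoubledSeesawParabolic.omega_blkD_inl_sumTensor` / `DoubledSeesawUndoubling.omega_chiSplitting_sumTensor_idxSplit`, by LOCAL
Kudla rigidity instead of the adelic see-saw character.

Setting: a CM field `L`, `(maximalRealSubfield L)` its maximal real subfield, a finite place `v` of `(maximalRealSubfield L)` (split or not), symmetric Gram matrices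
`T₁ ∈ M_{n₁}((maximalRealSubfield L))` DIAGONAL (`T₁ = diag t₁`, `0 < n₁`) and `T₂ ∈ M_{n₂}((maximalRealSubfield L))` with unit determinants, `T = T₁ ⊕ᶠ T₂`, a Hecke
character `χ` of `L` with `IsSplittingChar L 1 χ`, Haar data `μ` at `v`.  The tree's CM local splitting of `U(T)((maximalRealSubfield L)_v)` is
`localSplittingCMWith L n ‹T› … χ hχ v μ = undoubleLoc (s^𝔻_T)`, `s^𝔻_T = (localSplittingDatumCM L v μ n … χ hχ).localSplitting`
the `P_Δ`-normalised section of the doubled group `U(T ⊕ −T)((maximalRealSubfield L)_v)` ([GelbartRogawski1991, §3.1 Prop. 3.1.1]; [Kudla1994, §3]).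

* (inputs, `LocalDoubledBlockEmbedding` / `LocalDoubledBlockSiegel`) `restrictBlk s` and `ω(s (blkLoc h))(Φ₁ ⊠ Φ₂) = ω(restrictBlk s h) Φ₁ ⊠ Φ₂`,
  the normalisation transfer `parabolic_restrictBlk`, the box of two movers `map_boxPair_deltaLagrangian`, `chiDet_blkLoc`, `detDelta_blkLoc`;
* §1 (CM data) **`restrictBlk (s^𝔻_{T₁ ⊕ᶠ T₂}) = s^𝔻_{T₁}`** (`restrictBlk_localSplittingDatumCM`): same projection, both
  `P_Δ(T₁)`-normalised with the SAME scalar (`χ_v(det_Δ)⁻¹ ∏_w ‖det_Δ‖_w^{1/2}` is blind to the block embedding: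
  `chiDet_blkLoc`, `detDelta_blkLoc`), and every character of `U(T₁^𝔻)((maximalRealSubfield L)_v)` trivial on `P_Δ` is trivial (★
  `eq_one_of_forall_isSiegelDelta_eq_one'`, diagonal `T₁`, every finite place) — ★ `eq_of_parabolic_toRep_conj_eq`;
* §2 **THE LOCAL SEE-SAW** `restrictLeft (localSplittingCMWith ‹T₁ ⊕ᶠ T₂›) = localSplittingCMWith ‹T₁›`
  (`restrictLeft_localSplittingCMWith`): undouble §4 through the doubling square `(g₁ ⊕ 1) ⊕ 1 = blkLoc (g₁ ⊕ 1)` and the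
  four-fold shuffle `(f₁ ⊠ f₂) ⊠ (f₃ ⊠ f₄) = (f₁ ⊠ f₃) ⊠_{blkIdx} (f₂ ⊠ f₄)`, `⊠`-cancellation; operator form
  **`ω_T(s_T (g₁ ⊕ 1))(f₁ ⊠ f₂) = ω_{T₁}(s_{T₁} g₁) f₁ ⊠ f₂`** (`toRep_localSplittingCMWith_inlLoc_boxSB`).

Consumer: crux H413 (cell `hodgecm-mathlib`), programme P2, N3 road clause (a), brick (LS) «LOCAL SEE-SAW» of the lead's dealing
2026-08-31T22:04Z: Kudla's tower compatibility `r_{N(ℓ)}(ω_{V,μ})|_{U(V₁)} = ω_{V₁,μ}` at a block-adapted frame.  HC_CM is NOT proved here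
and is proved only modulo the printed citations until rung 0 closes.

## References
* [Kudla1994] S. Kudla, *Splitting metaplectic covers of dual reductive pairs*, Israel J. Math. 87 (1994), §3 Thm. 3.1 (the
  splitting is pinned by its Siegel-parabolic values; compatibility with see-saw pairs).
* [Kudla1984] S. Kudla, *Seesaw dual reductive pairs*, Progr. Math. 46 (1984), §1.
* [HarrisKudlaSweet1996] M. Harris, S. Kudla, W. Sweet, J. AMS 9 (1996), §1 (1.9)–(1.16).
* [GelbartRogawski1991] S. Gelbart, J. Rogawski, Invent. Math. 105 (1991), §3.1 Prop. 3.1.1 p. 455, Remark p. 457 L4–13.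
* [MoeglinVignerasWaldspurger1987] LNM 1291 (1987), Chap. 2 II.1 Rem. (6).
-/

set_option autoImplicit false

noncomputable section

open NumberField IsDedekindDomain Matrix MeasureTheory
open Literature.RepresentationTheory.HeisenbergGroup
open Literature.NumberTheory.Automorphic Literature.NumberTheory.Weil1964
open Literature.NumberTheory.GaloisRepresentations Literature.RepresentationTheory.HarrisKudlaSweet1996

namespace Literature.NumberTheory.GelbartRogawski1991.UnitaryDualPair.LocalSplitting

namespace DoubledBlock

/-! ## §1 The CM data: the block section of `s^𝔻_{T₁ ⊕ᶠ T₂}` IS `s^𝔻_{T₁}` -/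

section CM

variable (L : Type) [Field L] [NumberField L] [IsCMField L] (v : HeightOneSpectrum (𝓞 (maximalRealSubfield L)))
  [MeasurableSpace (v.adicCompletion (maximalRealSubfield L))] [BorelSpace (v.adicCompletion (maximalRealSubfield L))]
  (μ : Measure (v.adicCompletion (maximalRealSubfield L))) [μ.IsAddHaarMeasure]
  (n₁ n₂ : ℕ) {T₁ : Matrix (Fin n₁) (Fin n₁) (maximalRealSubfield L)} {T₂ : Matrix (Fin n₂) (Fin n₂) (maximalRealSubfield L)}
  (hT₁ : T₁.IsSymm) (hT₂ : T₂.IsSymm) (hT₁d : IsUnit T₁.det) (hT₂d : IsUnit T₂.det)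
  (χ : HeckeCharacter L) (hχ : IsSplittingChar L 1 χ)

omit [NumberField L] [IsCMField L] in
include hT₁d hT₂d in
/-- `det (T₁ ⊕ᶠ T₂)` is a unit. [cite: Kudla1984, §1] -/
theorem isUnit_det_finSum : IsUnit (UnitaryGroup.finSum n₁ n₂ T₁ T₂).det := by
  rw [UnitaryGroup.finSum, Matrix.det_reindex_self, Matrix.det_fromBlocks_zero₂₁]
  exact hT₁d.mul hT₂d

set_option maxHeartbeats 4000000 in -- the doubled CM datum's telescope (as in ★ `LocalSplittingCMScaleTransport`)
/-- **THE BLOCK SECTION OF THE DOUBLED CM SECTION OF `T₁ ⊕ᶠ T₂` IS THE DOUBLED CM SECTION OF `T₁`** (`T₁` diagonal, `0 < n₁`;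
every finite place): both are sections over `ι^𝔻_{T₁}`, both are `P_Δ(T₁)`-normalised with the scalar `χ_v(det_Δ)⁻¹ ∏_w ‖det_Δ‖_w^{1/2}`
(the scalar of `T₁ ⊕ᶠ T₂` at `blkLoc p₁` is the scalar of `T₁` at `p₁`: `chiDet_blkLoc`, `detDelta_blkLoc`; normalisation
transfer `parabolic_restrictBlk` through the box of two movers), and such sections are unique (★ `eq_of_parabolic_toRep_conj_eq`,
★ `eq_one_of_forall_isSiegelDelta_eq_one'`). [cite: Kudla1994, §3 Thm. 3.1] [cite: GelbartRogawski1991, §3.1 Remark p. 457 L4–13] -/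
theorem restrictBlk_localSplittingDatumCM (hn₁ : 0 < n₁) (t₁ : Fin n₁ → (maximalRealSubfield L)) (hT₁t : T₁ = Matrix.diagonal t₁) :
    restrictBlk (maximalRealSubfield L) L (IsCMField.complexConj L) v n₁ n₂ (T₁ := T₁) (T₂ := T₂) rfl rfl (complexConj_imagUnit L) (imagUnit_ne_zero L) (imagUnit_mul_self L)
        hT₁ hT₂ hT₂d
        (localSplittingDatumCM L v μ (n₁ + n₂) (UnitaryGroup.isSymm_finSum hT₁ hT₂)
          (isUnit_det_finSum L n₁ n₂ hT₁d hT₂d) rfl χ hχ).localSplitting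
        (fun h => (localSplittingDatumCM L v μ (n₁ + n₂) (UnitaryGroup.isSymm_finSum hT₁ hT₂)
          (isUnit_det_finSum L n₁ n₂ hT₁d hT₂d) rfl χ hχ).proj_localSplitting h) =
      (localSplittingDatumCM L v μ n₁ hT₁ hT₁d rfl χ hχ).localSplitting := by
  -- movers of `ℓ_Δ` onto `ℓ_Y` for the two blocks, and their box
  obtain ⟨m₁, hm₁⟩ := exists_mover_deltaLagrangian (maximalRealSubfield L) v n₁ (T₀ := T₁) hT₁d
  obtain ⟨m₂, hm₂⟩ := exists_mover_deltaLagrangian (maximalRealSubfield L) v n₂ (T₀ := T₂) hT₂d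
  have hm : (deltaLagrangian (maximalRealSubfield L) v (n₁ + n₂)).map (toLin (maximalRealSubfield L) v (MpPsi.proj _
      (boxLoc (maximalRealSubfield L) v n₁ n₂ (T₁ := T₁) (T₂ := T₂) (m₁, m₂)))) = lagrangianY (maximalRealSubfield L) ((n₁ + n₂) + (n₁ + n₂)) v := by
    rw [proj_boxLoc]
    exact map_boxPair_deltaLagrangian (maximalRealSubfield L) v n₁ n₂ _ _ hm₁ hm₂
  -- rigidity on `U(T₁^𝔻)((maximalRealSubfield L)_v)`
  refine eq_of_parabolic_toRep_conj_eq (maximalRealSubfield L) L (IsCMField.complexConj L) (complexConj_imagUnit L) (imagUnit_ne_zero L) (imagUnit_mul_self L) v n₁ hT₁ hT₁d rfl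
    _ _ (fun g => ?_) (fun θ hθ => ?_)
    (fun p => (((chiDet (maximalRealSubfield L) L (IsCMField.complexConj L) v n₁ (fun w' : UnitaryGroup.PlacesOver L v => (χ.localComponent w'.1)⁻¹) p)⁻¹ : ℂˣ) : ℂ) *
      ((∏ w' : UnitaryGroup.PlacesOver L v, Real.sqrt ‖detDelta (maximalRealSubfield L) L (IsCMField.complexConj L) v n₁ w' p‖ : ℝ) : ℂ))
    (fun p hp => parabolicScalar_ne_zero (maximalRealSubfield L) L (IsCMField.complexConj L) (complexConj_imagUnit L) (imagUnit_ne_zero L) (imagUnit_mul_self L) v n₁ hT₁ rfl _ hp)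
    m₁ (fun p hp Φ => parabolic_toRep_conj_localSplittingDatumCM L v μ n₁ hT₁ hT₁d rfl χ hχ m₁ hm₁ p hp Φ) (fun p hp Φ => ?_)
  · -- same projection
    rw [proj_restrictBlk, LocalSplittingDatum.proj_localSplitting]
  · -- characters trivial on `P_Δ(T₁)` are trivial
    exact eq_one_of_forall_isSiegelDelta_eq_one' (maximalRealSubfield L) L (IsCMField.complexConj L) (complexConj_imagUnit L) (imagUnit_ne_zero L) (imagUnit_mul_self L) v n₁
      hn₁ t₁ hT₁t hT₁ hT₁d rfl θ hθ
  · -- normalisation of the block section, transferred from `T₁ ⊕ᶠ T₂` through `j̃(m₁, m₂)`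
    have h := parabolic_restrictBlk (maximalRealSubfield L) L (IsCMField.complexConj L) v n₁ n₂ (T₁ := T₁) (T₂ := T₂) rfl rfl (complexConj_imagUnit L) (imagUnit_ne_zero L)
      (imagUnit_mul_self L) hT₁ hT₂ hT₂d
      (localSplittingDatumCM L v μ (n₁ + n₂) (UnitaryGroup.isSymm_finSum hT₁ hT₂) (isUnit_det_finSum L n₁ n₂ hT₁d hT₂d) rfl χ hχ).localSplitting
      (fun h => (localSplittingDatumCM L v μ (n₁ + n₂) (UnitaryGroup.isSymm_finSum hT₁ hT₂)
        (isUnit_det_finSum L n₁ n₂ hT₁d hT₂d) rfl χ hχ).proj_localSplitting h) m₁ m₂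
      (fun p => (((chiDet (maximalRealSubfield L) L (IsCMField.complexConj L) v (n₁ + n₂) (fun w' : UnitaryGroup.PlacesOver L v => (χ.localComponent w'.1)⁻¹) p)⁻¹ : ℂˣ) : ℂ) *
        ((∏ w' : UnitaryGroup.PlacesOver L v, Real.sqrt ‖detDelta (maximalRealSubfield L) L (IsCMField.complexConj L) v (n₁ + n₂) w' p‖ : ℝ) : ℂ))
      (fun p hp Φ => parabolic_toRep_conj_localSplittingDatumCM L v μ (n₁ + n₂) (UnitaryGroup.isSymm_finSum hT₁ hT₂)
        (isUnit_det_finSum L n₁ n₂ hT₁d hT₂d) rfl χ hχ _ hm p hp Φ) p hp Φ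
    rw [h]
    simp only [chiDet_blkLoc, detDelta_blkLoc]

end CM

/-! ## §2 THE LOCAL SEE-SAW: `restrictLeft (localSplittingCMWith ‹T₁ ⊕ᶠ T₂›) = localSplittingCMWith ‹T₁›` -/

section SeeSaw

variable (L : Type) [Field L] [NumberField L] [IsCMField L] (v : HeightOneSpectrum (𝓞 (maximalRealSubfield L)))
  [MeasurableSpace (v.adicCompletion (maximalRealSubfield L))] [BorelSpace (v.adicCompletion (maximalRealSubfield L))]
  (μ : Measure (v.adicCompletion (maximalRealSubfield L))) [μ.IsAddHaarMeasure]
  (n₁ n₂ : ℕ) {T₁ : Matrix (Fin n₁) (Fin n₁) (maximalRealSubfield L)} {T₂ : Matrix (Fin n₂) (Fin n₂) (maximalRealSubfield L)}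
  (hT₁ : T₁.IsSymm) (hT₂ : T₂.IsSymm) (hT₁d : IsUnit T₁.det) (hT₂d : IsUnit T₂.det)
  {J₁ : Matrix (Fin n₁) (Fin n₁) L} (hJ₁ : J₁ = T₁.map (algebraMap (maximalRealSubfield L) L))
  {J : Matrix (Fin (n₁ + n₂)) (Fin (n₁ + n₂)) L}
  (hJ : J = (UnitaryGroup.finSum n₁ n₂ T₁ T₂).map (algebraMap (maximalRealSubfield L) L))
  (χ : HeckeCharacter L) (hχ : IsSplittingChar L 1 χ)

set_option maxHeartbeats 8000000 in -- the doubled CM datum's telescope (as in ★ `LocalSplittingCMScaleTransport`)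
/-- **THE LOCAL SEE-SAW FOR KUDLA'S CM SPLITTING** (`T₁` diagonal, `0 < n₁`, every finite place `v` of `(maximalRealSubfield L)`): the left block
restriction of the CM local splitting of `U(T₁ ⊕ᶠ T₂)((maximalRealSubfield L)_v)` IS the CM local splitting of `U(T₁)((maximalRealSubfield L)_v)`:
`restrictLeft (localSplittingCMWith ‹T₁ ⊕ᶠ T₂› χ v μ) = localSplittingCMWith ‹T₁› χ v μ` — [Kudla1994, Thm. 3.1] «the splitting
determined by `χ` is compatible with the see-saw `U(V₁) × U(V₂) ⊂ U(V₁ ⊥ V₂)`», for the doubling-normalised packages of the tree.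
Proof: undouble `restrictBlk_localSplittingDatumCM` through the doubling square and the four-fold shuffle.
[cite: Kudla1994, §3 Thm. 3.1] [cite: Kudla1984, §1] [cite: MoeglinVignerasWaldspurger1987, Chap. 2 II.1 Rem. (6)] -/
theorem restrictLeft_localSplittingCMWith (hn₁ : 0 < n₁) (t₁ : Fin n₁ → (maximalRealSubfield L)) (hT₁t : T₁ = Matrix.diagonal t₁) :
    BlockSum.restrictLeft (maximalRealSubfield L) L (IsCMField.complexConj L) v n₁ n₂ hJ₁ hJ (complexConj_imagUnit L) (imagUnit_ne_zero L) (imagUnit_mul_self L) hT₁ hT₂ hT₂d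
        (localSplittingCMWith L (n₁ + n₂) (UnitaryGroup.isSymm_finSum hT₁ hT₂) (isUnit_det_finSum L n₁ n₂ hT₁d hT₂d) hJ χ hχ v μ)
        (proj_localSplittingCMWith L (n₁ + n₂) (UnitaryGroup.isSymm_finSum hT₁ hT₂) (isUnit_det_finSum L n₁ n₂ hT₁d hT₂d) hJ χ hχ v μ) =
      localSplittingCMWith L n₁ hT₁ hT₁d hJ₁ χ hχ v μ := by
  refine MonoidHom.ext fun g₁ => MpPsi.ext_of_proj_of_toOp ?_ ?_
  · rw [BlockSum.proj_restrictLeft, proj_localSplittingCMWith]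
  · refine LinearEquiv.ext fun f₁ => ?_
    rw [MpPsi.toOp_apply, MpPsi.toOp_apply, ← MpPsi.toRep_apply, ← MpPsi.toRep_apply]
    -- test vectors
    have hne₁ : (unitVec (maximalRealSubfield L) (Fin n₁) v : SchwartzBruhat (Fin n₁ → v.adicCompletion (maximalRealSubfield L))) ≠ 0 := fun h0 => by
      have h1 : ((unitVec (maximalRealSubfield L) (Fin n₁) v : SchwartzBruhat (Fin n₁ → v.adicCompletion (maximalRealSubfield L))) : (Fin n₁ → v.adicCompletion (maximalRealSubfield L)) → ℂ) 0 = 1 :=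
        unitVec_apply_of_mem fun i _ => (v.adicCompletionIntegers (maximalRealSubfield L)).zero_mem
      rw [h0, ZeroMemClass.coe_zero, Pi.zero_apply] at h1
      exact zero_ne_one h1
    have hne₂ : (unitVec (maximalRealSubfield L) (Fin n₂) v : SchwartzBruhat (Fin n₂ → v.adicCompletion (maximalRealSubfield L))) ≠ 0 := fun h0 => by
      have h1 : ((unitVec (maximalRealSubfield L) (Fin n₂) v : SchwartzBruhat (Fin n₂ → v.adicCompletion (maximalRealSubfield L))) : (Fin n₂ → v.adicCompletion (maximalRealSubfield L)) → ℂ) 0 = 1 :=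
        unitVec_apply_of_mem fun i _ => (v.adicCompletionIntegers (maximalRealSubfield L)).zero_mem
      rw [h0, ZeroMemClass.coe_zero, Pi.zero_apply] at h1
      exact zero_ne_one h1
    set f₂ := unitVec (maximalRealSubfield L) (Fin n₂) v with hf₂
    set f₃ := unitVec (maximalRealSubfield L) (Fin n₁) v with hf₃
    -- the doubled operator on `(f₁ ⊠ f₂) ⊠ (f₃ ⊠ f₂)`, read two ways
    have hA := toRep_undoubleLoc_boxSB (maximalRealSubfield L) L (IsCMField.complexConj L) v (n₁ + n₂) hJ rfl (complexConj_imagUnit L) (imagUnit_ne_zero L) (imagUnit_mul_self L)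
      (UnitaryGroup.isSymm_finSum hT₁ hT₂) (isUnit_det_finSum L n₁ n₂ hT₁d hT₂d)
      (localSplittingDatumCM L v μ (n₁ + n₂) (UnitaryGroup.isSymm_finSum hT₁ hT₂) (isUnit_det_finSum L n₁ n₂ hT₁d hT₂d) rfl χ hχ).localSplitting
      (fun h => (localSplittingDatumCM L v μ (n₁ + n₂) (UnitaryGroup.isSymm_finSum hT₁ hT₂)
        (isUnit_det_finSum L n₁ n₂ hT₁d hT₂d) rfl χ hχ).proj_localSplitting h)
      (BlockSum.inlLoc (maximalRealSubfield L) L (IsCMField.complexConj L) v n₁ n₂ hJ₁ hJ g₁)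
      (boxSB (v.adicCompletion (maximalRealSubfield L)) (finSumFinEquiv : Fin n₁ ⊕ Fin n₂ ≃ Fin (n₁ + n₂)) f₁ f₂)
      (boxSB (v.adicCompletion (maximalRealSubfield L)) (finSumFinEquiv : Fin n₁ ⊕ Fin n₂ ≃ Fin (n₁ + n₂)) f₃ f₂)
    -- left reading: `((ω₁(restrictLeft … g₁) f₁) ⊠ f₂) ⊠ (f₃ ⊠ f₂)`
    have hL := BlockSum.toRep_inlLoc_boxSB (maximalRealSubfield L) L (IsCMField.complexConj L) v n₁ n₂ hJ₁ hJ (complexConj_imagUnit L) (imagUnit_ne_zero L) (imagUnit_mul_self L)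
      hT₁ hT₂ hT₂d
      (localSplittingCMWith L (n₁ + n₂) (UnitaryGroup.isSymm_finSum hT₁ hT₂) (isUnit_det_finSum L n₁ n₂ hT₁d hT₂d) hJ χ hχ v μ)
      (proj_localSplittingCMWith L (n₁ + n₂) (UnitaryGroup.isSymm_finSum hT₁ hT₂) (isUnit_det_finSum L n₁ n₂ hT₁d hT₂d) hJ χ hχ v μ)
      g₁ f₁ f₂
    -- right reading: through the doubling square and the shuffle
    have hsq := inlLoc_inlLoc_eq_blkLoc_inlLoc (maximalRealSubfield L) L (IsCMField.complexConj L) v n₁ n₂ (T₁ := T₁) (T₂ := T₂) (rfl : (gramD (maximalRealSubfield L) n₁ T₁).map (algebraMap (maximalRealSubfield L) L) = _)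
      (rfl : (gramD (maximalRealSubfield L) (n₁ + n₂) (UnitaryGroup.finSum n₁ n₂ T₁ T₂)).map (algebraMap (maximalRealSubfield L) L) = _) hJ₁ hJ g₁
    have hR := toRep_blkLoc_boxSB (maximalRealSubfield L) L (IsCMField.complexConj L) v n₁ n₂ (T₁ := T₁) (T₂ := T₂) rfl rfl (complexConj_imagUnit L) (imagUnit_ne_zero L)
      (imagUnit_mul_self L) hT₁ hT₂ hT₂d
      (localSplittingDatumCM L v μ (n₁ + n₂) (UnitaryGroup.isSymm_finSum hT₁ hT₂) (isUnit_det_finSum L n₁ n₂ hT₁d hT₂d) rfl χ hχ).localSplitting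
      (fun h => (localSplittingDatumCM L v μ (n₁ + n₂) (UnitaryGroup.isSymm_finSum hT₁ hT₂)
        (isUnit_det_finSum L n₁ n₂ hT₁d hT₂d) rfl χ hχ).proj_localSplitting h)
      (LocalSplitting.inlLoc (maximalRealSubfield L) L (IsCMField.complexConj L) v n₁ hJ₁ rfl g₁)
      (boxSB (v.adicCompletion (maximalRealSubfield L)) (e₂ n₁) f₁ f₃) (boxSB (v.adicCompletion (maximalRealSubfield L)) (e₂ n₂) f₂ f₂)
    rw [restrictBlk_localSplittingDatumCM L v μ n₁ n₂ hT₁ hT₂ hT₁d hT₂d χ hχ hn₁ t₁ hT₁t,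
      toRep_undoubleLoc_boxSB (maximalRealSubfield L) L (IsCMField.complexConj L) v n₁ hJ₁ rfl (complexConj_imagUnit L) (imagUnit_ne_zero L) (imagUnit_mul_self L) hT₁ hT₁d
        _ (fun h => (localSplittingDatumCM L v μ n₁ hT₁ hT₁d rfl χ hχ).proj_localSplitting h),
      ← hsq, ← boxSB_boxSB_shuffle, ← boxSB_boxSB_shuffle, hA] at hR
    -- `hR : (ω_T(s_T (g₁ ⊕ 1)) (f₁ ⊠ f₂)) ⊠ (f₃ ⊠ f₂) = ((ω₁(s_{T₁} g₁) f₁) ⊠ f₃ … )`; compare with `hL` and cancel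
    change MpPsi.toRep _ (undoubleLoc (maximalRealSubfield L) L (IsCMField.complexConj L) v (n₁ + n₂) hJ rfl (complexConj_imagUnit L) (imagUnit_ne_zero L) (imagUnit_mul_self L)
        (UnitaryGroup.isSymm_finSum hT₁ hT₂) (isUnit_det_finSum L n₁ n₂ hT₁d hT₂d) _ _ (BlockSum.inlLoc (maximalRealSubfield L) L (IsCMField.complexConj L) v n₁ n₂ hJ₁ hJ g₁)) _ = _ at hL
    rw [hL] at hR
    have h1 := boxSB_left_cancel (v.adicCompletion (maximalRealSubfield L)) (e₂ (n₁ + n₂)) (boxSB_ne_zero (v.adicCompletion (maximalRealSubfield L)) _ hne₁ hne₂) hR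
    exact boxSB_left_cancel (v.adicCompletion (maximalRealSubfield L)) _ hne₂ h1

set_option maxHeartbeats 1600000 in -- the doubled CM datum's telescope
/-- **THE LOCAL SEE-SAW, OPERATOR FORM**: `ω_T(s_T (g₁ ⊕ 1))(f₁ ⊠ f₂) = ω_{T₁}(s_{T₁} g₁) f₁ ⊠ f₂` — on `𝒮((maximalRealSubfield L)_v^{n₁+n₂}) =
𝒮((maximalRealSubfield L)_v^{n₁}) ⊗ 𝒮((maximalRealSubfield L)_v^{n₂})` the CM Weil representation of `U(T₁ ⊕ᶠ T₂)` restricted to `U(T₁) × 1` is `ω_{T₁,χ} ⊠ 1` for the CM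
package OF `T₁` (not merely for some section of `U(T₁)`). [cite: Kudla1994, §3 Thm. 3.1] [cite: Kudla1984, §1] -/
theorem toRep_localSplittingCMWith_inlLoc_boxSB (hn₁ : 0 < n₁) (t₁ : Fin n₁ → (maximalRealSubfield L)) (hT₁t : T₁ = Matrix.diagonal t₁)
    (g₁ : UnitaryGroup.localPi L (IsCMField.complexConj L) n₁ J₁ v) (f₁ : SchwartzBruhat (Fin n₁ → v.adicCompletion (maximalRealSubfield L)))
    (f₂ : SchwartzBruhat (Fin n₂ → v.adicCompletion (maximalRealSubfield L))) :
    MpPsi.toRep (localSchrodinger (maximalRealSubfield L) (n₁ + n₂) (UnitaryGroup.finSum n₁ n₂ T₁ T₂) v)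
        (localSplittingCMWith L (n₁ + n₂) (UnitaryGroup.isSymm_finSum hT₁ hT₂) (isUnit_det_finSum L n₁ n₂ hT₁d hT₂d) hJ χ hχ v μ
          (BlockSum.inlLoc (maximalRealSubfield L) L (IsCMField.complexConj L) v n₁ n₂ hJ₁ hJ g₁))
        (boxSB (v.adicCompletion (maximalRealSubfield L)) (finSumFinEquiv : Fin n₁ ⊕ Fin n₂ ≃ Fin (n₁ + n₂)) f₁ f₂) =
      boxSB (v.adicCompletion (maximalRealSubfield L)) (finSumFinEquiv : Fin n₁ ⊕ Fin n₂ ≃ Fin (n₁ + n₂))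
        (MpPsi.toRep (localSchrodinger (maximalRealSubfield L) n₁ T₁ v) (localSplittingCMWith L n₁ hT₁ hT₁d hJ₁ χ hχ v μ g₁) f₁) f₂ := by
  rw [BlockSum.toRep_inlLoc_boxSB (maximalRealSubfield L) L (IsCMField.complexConj L) v n₁ n₂ hJ₁ hJ (complexConj_imagUnit L) (imagUnit_ne_zero L) (imagUnit_mul_self L)
    hT₁ hT₂ hT₂d _ (proj_localSplittingCMWith L (n₁ + n₂) (UnitaryGroup.isSymm_finSum hT₁ hT₂) (isUnit_det_finSum L n₁ n₂ hT₁d hT₂d)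
      hJ χ hχ v μ), restrictLeft_localSplittingCMWith L v μ n₁ n₂ hT₁ hT₂ hT₁d hT₂d hJ₁ hJ χ hχ hn₁ t₁ hT₁t]

include hT₂ hT₂d in
/-- **THE LOCAL SEE-SAW, OPERATOR FORM, for ANY Gram matrix EQUAL to a block sum** (`hTsum : T = T₁ ⊕ᶠ T₂`; the consumer's `T` is
typically a concrete diagonal matrix, e.g. `gram e (realDiagonal dV) (T_W ε)` at a block-adapted frame, and cannot be `subst`ed on
its side — here `T` is a variable and the proof is `subst hTsum`): `ω_T(s_T (g₁ ⊕ 1))(f₁ ⊠ f₂) = ω_{T₁}(s_{T₁} g₁) f₁ ⊠ f₂`.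
[cite: Kudla1994, §3 Thm. 3.1] [cite: Kudla1984, §1] -/
theorem toRep_localSplittingCMWith_inlLoc_boxSB_of_eq {T : Matrix (Fin (n₁ + n₂)) (Fin (n₁ + n₂)) (maximalRealSubfield L)}
    (hTsum : T = UnitaryGroup.finSum n₁ n₂ T₁ T₂) (hT : T.IsSymm) (hTd : IsUnit T.det)
    {J' : Matrix (Fin (n₁ + n₂)) (Fin (n₁ + n₂)) L} (hJ' : J' = T.map (algebraMap (maximalRealSubfield L) L))
    (hn₁ : 0 < n₁) (t₁ : Fin n₁ → (maximalRealSubfield L)) (hT₁t : T₁ = Matrix.diagonal t₁)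
    (g₁ : UnitaryGroup.localPi L (IsCMField.complexConj L) n₁ J₁ v) (f₁ : SchwartzBruhat (Fin n₁ → v.adicCompletion (maximalRealSubfield L)))
    (f₂ : SchwartzBruhat (Fin n₂ → v.adicCompletion (maximalRealSubfield L))) :
    MpPsi.toRep (localSchrodinger (maximalRealSubfield L) (n₁ + n₂) T v)
        (localSplittingCMWith L (n₁ + n₂) hT hTd hJ' χ hχ v μ
          (BlockSum.inlLoc (maximalRealSubfield L) L (IsCMField.complexConj L) v n₁ n₂ hJ₁ (hJ'.trans (by rw [hTsum])) g₁))
        (boxSB (v.adicCompletion (maximalRealSubfield L)) (finSumFinEquiv : Fin n₁ ⊕ Fin n₂ ≃ Fin (n₁ + n₂)) f₁ f₂) =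
      boxSB (v.adicCompletion (maximalRealSubfield L)) (finSumFinEquiv : Fin n₁ ⊕ Fin n₂ ≃ Fin (n₁ + n₂))
        (MpPsi.toRep (localSchrodinger (maximalRealSubfield L) n₁ T₁ v) (localSplittingCMWith L n₁ hT₁ hT₁d hJ₁ χ hχ v μ g₁) f₁) f₂ := by
  subst hTsum
  exact toRep_localSplittingCMWith_inlLoc_boxSB L v μ n₁ n₂ hT₁ hT₂ hT₁d hT₂d hJ₁ hJ' χ hχ hn₁ t₁ hT₁t g₁ f₁ f₂

end SeeSaw


end DoubledBlock

end Literature.NumberTheory.GelbartRogawski1991.UnitaryDualPair.LocalSplitting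

end
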